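import Literature.AnabelianGeometry.SemiGraphs.PSCGraphicity
import Literature.AnabelianGeometry.SemiGraphs.PSCRamification
import Literature.AnabelianGeometry.SemiGraphs.Coverticial
import HarnessLib

/-!
# [CombGC] Theorem 1.6, sub-DAG statements I: the rank statements of Remarks 1.1.3, 1.1.4, 1.3.1

Mochizuki, *A combinatorial version of the Grothendieck conjecture*, Tohoku Math. J. **59** (2007)
[CombGC], §1, author's manuscript pp. 7–10.  STATEMENTS-FIRST sub-DAG typing (human ruling D-0068
(1); cell file plan/L3/SUBDAG-CombGC-Thm16.md, rows T16-L15 and T16-L08; seat abc-iut-w4-d052) of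
the printed inputs that the proof of Theorem 1.6 (ii)(iii) (p. 14, as amended by [IUTchI] Rmk. 1.2.3
(iii)(vii)) uses and that `PSCFundamentalGroup.lean` (abc-iut-L3-t4) deliberately left untyped:

* Remark 1.1.3 / 1.1.4 (pp. 7–8): "`Π^grph_G` is a finitely generated, free pro-`Σ` group of rank
  `n(G) − i(G) + 1`"; "`M_G / M^vert_G` [i.e., the abelianization of `Π^grph_G`] … free and finitely
  generated over `Ẑ^Σ`" — typed at the level the proof consumes it, for every finite étale covering
  `G_U` (open `U ≤ Π_G`): `M_{G_U} / M^vert_{G_U} = U / vertFil U` is THE pro-`Σ` completion of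
  `ℤ^{n(G_U) − i(G_U) + 1}` (`n(G_U) = nodeCount U`, `i(G_U) = vertCount U`, the double-coset counts of
  `PSCFundamentalGroup.lean`): `PSCDatum.AbelianizedGrphRank`.
* Remark 1.3.1 (p. 10), the consequence of Prop. 1.3 (Poincaré duality; continuous group cohomology
  is not in the tree, so Prop. 1.3 itself stays untyped): for sturdy `G`, "the ranks [over `Ẑ^Σ`] of
  `M^edge_G / M^cusp_G`, `M_G / M^vert_G` coincide"; "if `G` has cusps, then the rank of `M^cusp_G` is
  `r(G) − 1`"; "`G` is noncuspidal if and only if `M^cusp_{G'} = 0` for all finite étale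
  `Π_G`-coverings `G' → G`" — `PSCDatum.DualityRankEq`, `PSCDatum.CuspRank`,
  `PSCDatum.NoncuspidalIffCuspFilTrivial`; the printed conclusion "one may compute `r(G)` as soon as
  one knows the difference between the ranks of `M^edge_{G'}`, `M_{G'}/M^vert_{G'}` for all finite étale
  `Π_G`-coverings" is what makes "graphically filtration-preserving ⟹ numerically cuspidal" in the
  proof of Thm. 1.6 (ii).

Rendering.  "Free of rank `r` over `Ẑ^Σ`" for the profinite abelian groups `U / vertFil U`,
`edgeFil U / cuspFil U`, `cuspFil U / \overline{[U,U]}` is rendered as "is the pro-`Σ` completion of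
`ℤ^r`" through the tree's `SemiGraphOfAnabelioids.IsProSigmaCompletion` ([SemiAnbd] Ex. 2.10
interface, `Coverticial.lean`), the dense homomorphism being part of the existential; the quotient
groups are formed under a displayed normality hypothesis (always satisfied: every subgroup between
`[U,U]` and `U` is normal in `U`), so no instance is declared.  These are SUB-NODE STATEMENTS
(decomposition steps of a printed proof; GEOMETRIC-ORIGIN content, FALSE for arbitrary data like
Prop. 1.2 — hence predicates ON the datum plus `…Holds Ω` bundles over the origin parameter), not
FACT-LIST facts; nothing is asserted; typed ≠ proved; nothing here takes a side on [IUTchIII] Cor.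
3.12. [cite: MochizukiCombGC2007, Rmk 1.1.3 p.8] [cite: MochizukiCombGC2007, Rmk 1.3.1 p.10]
-/

namespace Literature.AnabelianGeometry.SemiGraphs

namespace PSCDatum

open SemiGraphOfAnabelioids (IsProSigmaCompletion)

universe u

variable {P : Type u} [Group P] [TopologicalSpace P] [IsTopologicalGroup P]

/-! ### Remark 1.1.3 / 1.1.4: the rank of `M / M^vert` -/

/-- **[CombGC] Remark 1.1.3 (with 1.1.4)**, p. 8, at the level of finite étale coverings: for every
open `U ≤ Π_G` (the covering `G_U`), the profinite abelian group `M_{G_U} / M^vert_{G_U} = U / vertFil U`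
("the abelianization of `Π^grph_{G_U}`", Rmk. 1.1.4) is free over `Ẑ^Σ` of rank
`n(G_U) − i(G_U) + 1` ("`Π^grph_G` is a finitely generated, free pro-`Σ` group of rank
`n(G) − i(G) + 1`", Rmk. 1.1.3) — i.e. it is the pro-`Σ` completion of `ℤ^{n(G_U) + 1 − i(G_U)}`.
A predicate on the datum (geometric-origin content), not asserted.
[cite: MochizukiCombGC2007, Rmk 1.1.3 p.8] -/
def AbelianizedGrphRank (G : PSCDatum P) : Prop :=
  ∀ (U : Subgroup P), IsOpen (U : Set P) → ∀ [((G.vertFil U).subgroupOf U).Normal],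
    ∃ ι : Multiplicative (Fin (G.nodeCount U + 1 - G.vertCount U) → ℤ) →*
        U ⧸ (G.vertFil U).subgroupOf U,
      IsProSigmaCompletion G.Sigma ι

/-! ### Remark 1.3.1: the three rank statements behind "filtration-preserving ⟹ numerically cuspidal" -/

/-- **[CombGC] Remark 1.3.1, first claim**, p. 10: "if `G` is a sturdy semi-graph of anabelioids of
PSC-type, then the ranks [over `Ẑ^Σ`] of `M^edge_G / M^cusp_G`, `M_G / M^vert_G` coincide" (by Prop.
1.3 applied to the compactification), at the level of finite étale coverings `G_U` of a sturdy `G`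
(all sturdy): `edgeFil U / cuspFil U` and `U / vertFil U` are pro-`Σ` completions of the SAME `ℤ^r`.
A predicate on the datum, not asserted. [cite: MochizukiCombGC2007, Rmk 1.3.1 p.10] -/
def DualityRankEq (G : PSCDatum P) : Prop :=
  G.IsSturdy → ∀ (U : Subgroup P), IsOpen (U : Set P) →
    ∀ [((G.vertFil U).subgroupOf U).Normal] [((G.cuspFil U).subgroupOf (G.edgeFil U)).Normal],
    ∃ (r : ℕ) (ι₁ : Multiplicative (Fin r → ℤ) →* U ⧸ (G.vertFil U).subgroupOf U)
      (ι₂ : Multiplicative (Fin r → ℤ) →* G.edgeFil U ⧸ (G.cuspFil U).subgroupOf (G.edgeFil U)),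
      IsProSigmaCompletion G.Sigma ι₁ ∧ IsProSigmaCompletion G.Sigma ι₂

/-- **[CombGC] Remark 1.3.1, second claim**, p. 10: "if `G` has cusps, then the rank of `M^cusp_G` is
equal to `r(G) − 1`", at the level of finite étale coverings: for open `U` with `r(G_U) > 0`,
`M^cusp_{G_U} = cuspFil U / \overline{[U,U]}` is the pro-`Σ` completion of `ℤ^{r(G_U) − 1}`
(`r(G_U) = cuspCount U`).  A predicate on the datum, not asserted. [cite: MochizukiCombGC2007, Rmk 1.3.1 p.10] -/
def CuspRank (G : PSCDatum P) : Prop :=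
  ∀ (U : Subgroup P), IsOpen (U : Set P) → 0 < G.cuspCount U →
    ∀ [((⁅U, U⁆.topologicalClosure).subgroupOf (G.cuspFil U)).Normal],
    ∃ ι : Multiplicative (Fin (G.cuspCount U - 1) → ℤ) →*
        G.cuspFil U ⧸ (⁅U, U⁆.topologicalClosure).subgroupOf (G.cuspFil U),
      IsProSigmaCompletion G.Sigma ι

/-- **[CombGC] Remark 1.3.1, third claim**, p. 10: "`G` is noncuspidal if and only if
`M^cusp_{G'} = 0` for all finite étale `Π_G`-coverings `G' → G`" — `M^cusp_{G_U} = 0` reading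
`cuspFil U = \overline{[U,U]}`.  A predicate on the datum, not asserted ("it follows immediately
from the definitions" for the intended data). [cite: MochizukiCombGC2007, Rmk 1.3.1 p.10] -/
def NoncuspidalIffCuspFilTrivial (G : PSCDatum P) : Prop :=
  G.graph.IsNoncuspidal ↔
    ∀ U : Subgroup P, IsOpen (U : Set P) → G.cuspFil U = (⁅U, U⁆).topologicalClosure

/-! ### The printed statements over the origin parameter -/

section Statements

variable (Ω : PSCOrigin.{u})

/-- **[CombGC] Remarks 1.1.3/1.1.4 and 1.3.1 as printed**, for every `G` of PSC-type: the rank of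
`M/M^vert` at every covering, the duality rank equality for sturdy `G`, the cusp rank, and the
noncuspidality criterion. [cite: MochizukiCombGC2007, Rmk 1.3.1 p.10] -/
def RankStatementsHold : Prop :=
  ∀ ⦃Q : Type u⦄ [Group Q] [TopologicalSpace Q] [IsTopologicalGroup Q] (G : PSCDatum Q),
    Ω.IsOfPSCType G →
      G.AbelianizedGrphRank ∧ G.DualityRankEq ∧ G.CuspRank ∧ G.NoncuspidalIffCuspFilTrivial

end Statements

end PSCDatum

end Literature.AnabelianGeometry.SemiGraphs

/-! ## Statements III (appended, abc-iut-w4-d052): the rank of `M^unr_G[v]` (Def. 1.1 (ii) / Rmk. 1.1.5)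

[CombGC] Definition 1.1 (ii), p. 7: "If the abelianization of every unramified verticial subgroup of
`Π^unr_G` is free of rank ≥ 2 over `Ẑ^Σ`, then we shall say that `G` is sturdy"; Remark 1.1.5, p. 8:
"the condition that … `G` … be sturdy corresponds to the condition that every irreducible component
of the pointed stable curve that gives rise to `G` be of genus ≥ 2. [Indeed, this follows immediately
from the well-known structure of fundamental groups of Riemann surfaces.]"; Remark 1.1.4, p. 8:
"`M^vert_G/M^edge_G` [i.e., the direct sum, over the set of vertices of `G`, of the abelianizations of
the corresponding unramified verticial subgroups of `Π^unr_G`] … free and finitely generated over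
`Ẑ^Σ`".  The tree types `IsSturdy` through the genus field (`2 ≤ genus v`); the link to the printed
definition is the "well-known structure": the abelianization of the unramified verticial subgroup at
`v` — whose image in `M^unr_G` is `M^unr_G[v] = unrVertAbOf v / unrAbKer` ([IUTchI] Rmk. 1.2.3 (i)) —
is free over `Ẑ^Σ` of rank `2 · genus(v)`.  This is the rank input under which the vertex-set
characterization `PSCGraphicitySub2.VertexSetCharacterization` ("[nontrivial!] quotients
`M^unr-vert_G ↠ M^unr_G[v] ⊗ F_l`") is derivable from `UnrVerticialCharacterizationHolds`
(sub-DAG row T16-L13 kernel).  Sub-node statement, not a FACT-LIST fact; not asserted.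
-/

namespace Literature.AnabelianGeometry.SemiGraphs.PSCDatum

open SemiGraphOfAnabelioids (IsProSigmaCompletion)

universe u

variable {P : Type u} [Group P] [TopologicalSpace P] [IsTopologicalGroup P]

/-- **[CombGC] Def. 1.1 (ii) / Rmk. 1.1.4 / Rmk. 1.1.5**, pp. 7–8 ("the abelianization of every
unramified verticial subgroup of `Π^unr_G` is free … over `Ẑ^Σ`"; "genus"; "the well-known structure
of fundamental groups of Riemann surfaces"): for every vertex `v`, the profinite abelian group
`M^unr_G[v] = unrVertAbOf v / unrAbKer` is the pro-`Σ` completion of `ℤ^{2·genus(v)}`.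
A predicate on the datum (geometric-origin content), not asserted.
[cite: MochizukiCombGC2007, Rmk 1.1.5 p.8] -/
def UnrVertAbOfRank (G : PSCDatum P) : Prop :=
  ∀ (v : G.graph.V) [((G.unrAbKer).subgroupOf (G.unrVertAbOf v)).Normal],
    ∃ ι : Multiplicative (Fin (2 * G.genus v) → ℤ) →*
        G.unrVertAbOf v ⧸ (G.unrAbKer).subgroupOf (G.unrVertAbOf v),
      IsProSigmaCompletion G.Sigma ι

section StatementsIII

variable (Ω : PSCOrigin.{u})

/-- **[CombGC] Def. 1.1 (ii) / Rmk. 1.1.4 / 1.1.5 as printed**, for every `G` of PSC-type: the rank of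
`M^unr_G[v]` is `2·genus(v)`. [cite: MochizukiCombGC2007, Rmk 1.1.5 p.8] -/
def UnrVertAbOfRankHolds : Prop :=
  ∀ ⦃Q : Type u⦄ [Group Q] [TopologicalSpace Q] [IsTopologicalGroup Q] (G : PSCDatum Q),
    Ω.IsOfPSCType G → G.UnrVertAbOfRank

end StatementsIII

end Literature.AnabelianGeometry.SemiGraphs.PSCDatum

/-! ## Statements IV (appended, abc-iut-w4-d052): the coverings are connected (Def. 1.1 (i) / Rmk. 1.1.3: `n − i + 1 ≥ 0`)

[CombGC] Definition 1.1 (i), p. 6, takes `G` to be the semi-graph of anabelioids "of pro-`Σ` PSC-type"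
arising from a pointed STABLE CURVE — its underlying (dual) semi-graph, and that of every finite étale
covering `G_U` (again a pointed stable curve), is connected — and Remark 1.1.3, p. 8, records the
consequence the proof of Theorem 1.6 uses: "`Π^grph_G` is a finitely generated, free pro-`Σ` group of
rank `n(G) − i(G) + 1`", a natural number, i.e. `i(G_U) ≤ n(G_U) + 1` for every covering.  The
statement `PSCDatum.AbelianizedGrphRank` above renders that rank with ℕ-truncated subtraction
`n + 1 − i`, so the inequality is a genuine separate input of the rank transport in the proof of
Thm. 1.6 (iii) ([IUTchI] Rmk. 1.2.3 (iii)'s display `i(G') = deg·(i(G) − 1) + 1` read in rank form;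
sub-DAG row T16-L16a, consumer abc-iut-L5-t6).  Typed here as a predicate ON the datum (geometric-
origin content, false for junk data) plus its `…Holds Ω` bundle; a SUB-NODE statement, not a
FACT-LIST fact; nothing asserted; typed ≠ proved; nothing here takes a side on [IUTchIII] Cor. 3.12.
-/

namespace Literature.AnabelianGeometry.SemiGraphs.PSCDatum

universe u

variable {P : Type u} [Group P] [TopologicalSpace P] [IsTopologicalGroup P]

/-- **[CombGC] Def. 1.1 (i), p. 6 / Rmk. 1.1.3, p. 8** (connectedness of the underlying semi-graph of
every finite étale covering of the pointed stable curve; "`Π^grph_G` is … free pro-`Σ` … of rank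
`n(G) − i(G) + 1`"): for every open `U ≤ Π_G`, the covering `G_U` has `i(G_U) ≤ n(G_U) + 1`
(`i(G_U) = vertCount U`, `n(G_U) = nodeCount U`).  A predicate on the datum (geometric-origin content),
not asserted. [cite: MochizukiCombGC2007, Rmk 1.1.3 p.8] -/
def VertCountLeNodeCountSucc (G : PSCDatum P) : Prop :=
  ∀ U : Subgroup P, IsOpen (U : Set P) → G.vertCount U ≤ G.nodeCount U + 1

section StatementsIV

variable (Ω : PSCOrigin.{u})

/-- **[CombGC] Def. 1.1 (i) / Rmk. 1.1.3 as printed**, for every `G` of PSC-type: every finite étale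
covering `G_U` satisfies `i(G_U) ≤ n(G_U) + 1`. [cite: MochizukiCombGC2007, Rmk 1.1.3 p.8] -/
def VertCountLeNodeCountSuccHolds : Prop :=
  ∀ ⦃Q : Type u⦄ [Group Q] [TopologicalSpace Q] [IsTopologicalGroup Q] (G : PSCDatum Q),
    Ω.IsOfPSCType G → G.VertCountLeNodeCountSucc

end StatementsIV

end Literature.AnabelianGeometry.SemiGraphs.PSCDatum
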